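import Summits.Ventures.PercRepro.Night2NonFatLevels
import Summits.Ventures.PercRepro.Night2LocalD3ZeroClosure
import Summits.Ventures.PercRepro.Night2LocalDQm1Lossy

/-!
# night-2: the NON-FAT case of (FAIR) — the structure of a lossy basis pair (gen 37)

For a basis pair `(B, z)`, `Q = insert z B` (`Q ∖ K` a basis of `V = G ∖ K`), `W = G ∖ Q`: the ACTIVE faces are the
`w ∈ Q ∖ K` with `faceOk Q w` (the face `Q.erase w` is a thin member); each requests `r_w = 7 / (6 (m_w + 2))` with
`m_w = |G ∖ cl (Q.erase w)| ≥ 3` when there is no fat closure, so `r_w ≤ 7/30` (`req_le_of_nonfat`), and the pair is lossy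
only if `Σ_{active} r_w > capS Q ≥ 11/18`:

* **`three_le_card_faceOk_of_loss_ne_zero`**: a lossy basis pair has at least three active faces;
* **`two_le_card_holes`**: an active face `w` has at least two HOLE points — points of `W` off `cl (Q.erase w)`
  (`G ∖ cl (Q.erase w) = {w} ∪ holes`);
* `rkN_insert_eq_card` / `indep_insert_of_basis_pair`: `Q` is independent (rank `6 = |Q|`), so by the modularity lemma
  `mem_clF_sdiff_of_forall_mem_clF_erase` (gen 12) a point in the closures `cl (Q.erase w)` of every `w ∈ A ⊆ Q` lies in
  `cl (Q ∖ A)`: with exactly three active faces `A` every point of `W` that is a hole of none of them lies on the basis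
  line `cl (Q ∖ A)` — the nested-line geometry (**`dead_mem_clF_of_three`**); with four or more active faces every point
  of `W` is a hole of some active face.
Paper: proofs/NIGHT-2-g37.md §4.
-/

namespace PercRepro.Shadow

open PercRepro.ThmH PercRepro.PerFlat

variable {α : Type*} [DecidableEq α] {M : Matroid α} [M.Finite] {G : Finset α}

/-! ## The requests of the faces -/

/-- With no fat closure every thin member requests at most `7/30`. -/
theorem req_le_of_nonfat (hG : G ∈ flatsQ M (5 + 1)) (hd : (gr M \ G).card = 2)
    (hnf : fatClosures M 5 G 2 = ∅) {B : Finset α} (hB : B ∈ thinMembers M 5 G) : req M 5 B ≤ 7 / 30 := by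
  rw [req_eq_of_thin hG hB, hd]
  have h3 := three_le_card_sdiff_of_nonfat hnf hB
  have h3' : (3 : ℚ) ≤ ((G \ clF M B).card : ℚ) := by exact_mod_cast h3
  unfold phiQ
  rw [div_le_div_iff₀ (by linarith) (by norm_num)]
  push_cast
  linarith

/-- **A lossy basis pair has at least three active faces**: `11/18 ≤ capS Q < L1 Q = Σ_{active} r_w ≤ (7/30) · #active`. -/
theorem three_le_card_faceOk_of_loss_ne_zero (hG : G ∈ flatsQ M (5 + 1)) (hd : (gr M \ G).card = 2)
    (hk : kColoops M G = 1) (hnf : fatClosures M 5 G 2 = ∅) {B : Finset α} (hB : B ∈ thinMembers M 5 G)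
    {z : α} (hz : z ∈ G \ clF M B) (hl0 : loss M 5 G B z ≠ 0) :
    3 ≤ ((insert z B \ coloops M G).filter (fun w => faceOk M G (insert z B) w)).card := by
  have hQG : insert z B ⊆ G := Finset.insert_subset (Finset.mem_sdiff.1 hz).1 (subset_G_of_mem_thinMembers hB)
  have hcap := capS_ge_eleven_eighteenths_two_one hd hk hQG
  have hlt := capS_lt_L1_of_loss_ne_zero hl0
  rw [L1_eq_sum_req_faces hG hd] at hlt
  have hsum : ∑ w ∈ (insert z B \ coloops M G).filter (fun w => faceOk M G (insert z B) w),
      req M 5 ((insert z B).erase w) ≤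
      ∑ _w ∈ (insert z B \ coloops M G).filter (fun w => faceOk M G (insert z B) w), (7 / 30 : ℚ) := by
    apply Finset.sum_le_sum
    intro w hw
    rw [Finset.mem_filter] at hw
    exact req_le_of_nonfat hG hd hnf hw.2.1
  rw [Finset.sum_const, nsmul_eq_mul] at hsum
  by_contra h
  rw [not_le] at h
  have h2 : (((insert z B \ coloops M G).filter (fun w => faceOk M G (insert z B) w)).card : ℚ) ≤ 2 := by
    exact_mod_cast (by omega : ((insert z B \ coloops M G).filter (fun w => faceOk M G (insert z B) w)).card ≤ 2)
  linarith

/-! ## The hole points of an active face -/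

/-- **An active face has at least two hole points**: `G ∖ cl (Q.erase w) ⊆ {w} ∪ (W ∖ cl (Q.erase w))` has `≥ 3` points. -/
theorem two_le_card_holes (hG : G ∈ flatsQ M (5 + 1)) (hnf : fatClosures M 5 G 2 = ∅) {Q : Finset α}
    (hQG : Q ⊆ G) {w : α} (hok : faceOk M G Q w) :
    2 ≤ ((G \ Q) \ clF M (Q.erase w)).card := by
  have h3 := three_le_card_sdiff_of_nonfat hnf hok.1
  have hsub : G \ clF M (Q.erase w) ⊆ insert w ((G \ Q) \ clF M (Q.erase w)) := by
    intro e he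
    rw [Finset.mem_sdiff] at he
    rw [Finset.mem_insert, Finset.mem_sdiff, Finset.mem_sdiff]
    by_cases hew : e = w
    · exact Or.inl hew
    · right
      refine ⟨⟨he.1, fun heQ => he.2 ?_⟩, he.2⟩
      exact subset_clF_of_subset_gr ((Finset.erase_subset _ _).trans (hQG.trans (mem_flatsQ.1 hG).1))
        (Finset.mem_erase.2 ⟨hew, heQ⟩)
  have := Finset.card_le_card hsub
  have h1 := Finset.card_insert_le w ((G \ Q) \ clF M (Q.erase w))
  omega

/-! ## The dead points of three faces lie on their basis line -/

/-- The covering set `Q = insert z B` of a basis pair has rank `6 = |Q|`. -/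
theorem rkN_insert_eq_card (hG : G ∈ flatsQ M (5 + 1)) (hd : (gr M \ G).card = 2) (hk : kColoops M G = 1)
    {B : Finset α} (hB : B ∈ thinMembers M 5 G) (hnP : ¬ bigP M G B) {z : α} (hz : z ∈ G \ clF M B) :
    rkN M (insert z B) = (insert z B).card := by
  have hd' : (gr M \ G).card ≤ 5 := by omega
  have h4 := card_sdiff_eq_four_of_not_bigP hG hd hk hB hnP
  have hKB : coloops M G ⊆ B := coloops_subset_of_mem_thinMembers hG hd' hB
  have hBG : B ⊆ G := subset_G_of_mem_thinMembers hB
  have hzB : z ∉ B := fun h => (Finset.mem_sdiff.1 hz).2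
    (subset_clF_of_subset_gr (hBG.trans (mem_flatsQ.1 hG).1) h)
  have hBcard : B.card = 5 := by
    have h1 := Finset.card_sdiff_add_card_eq_card hKB
    rw [← kColoops_eq_card_coloops, hk, h4] at h1
    omega
  have h5 := rkN_eq_five_of_mem_thinMembers hB
  have hr := rkN_insert_of_notMem_clF (M := M) ((mem_flatsQ.1 hG).1 (Finset.mem_sdiff.1 hz).1) (Finset.mem_sdiff.1 hz).2
  rw [hr, h5, Finset.card_insert_of_notMem hzB, hBcard]

/-- The covering set `Q = insert z B` of a basis pair is independent. -/
theorem indep_insert_of_basis_pair (hG : G ∈ flatsQ M (5 + 1)) (hd : (gr M \ G).card = 2) (hk : kColoops M G = 1)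
    {B : Finset α} (hB : B ∈ thinMembers M 5 G) (hnP : ¬ bigP M G B) {z : α} (hz : z ∈ G \ clF M B) :
    M.Indep ((insert z B : Finset α) : Set α) :=
  indep_of_rkN_eq_card (rkN_insert_eq_card hG hd hk hB hnP hz)

/-- Every point of `G` lies in the closure of the covering set `Q` (of rank `6 = rk G`). -/
theorem mem_clF_insert_of_mem (hG : G ∈ flatsQ M (5 + 1)) (hd : (gr M \ G).card = 2) (hk : kColoops M G = 1)
    {B : Finset α} (hB : B ∈ thinMembers M 5 G) (hnP : ¬ bigP M G B) {z : α} (hz : z ∈ G \ clF M B)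
    {y : α} (hyG : y ∈ G) : y ∈ clF M (insert z B) := by
  have hQG : insert z B ⊆ G := Finset.insert_subset (Finset.mem_sdiff.1 hz).1 (subset_G_of_mem_thinMembers hB)
  have hGg : G ⊆ gr M := (mem_flatsQ.1 hG).1
  by_contra hy
  have h1 := rkN_insert_of_notMem_clF (M := M) (hGg hyG) hy
  have h2 : rkN M (insert y (insert z B)) ≤ rkN M G := rkN_mono (Finset.insert_subset hyG hQG)
  have h3 : rkN M G = 6 := by
    unfold rkN
    rw [(mem_flatsQ.1 hG).2.2]
    rfl
  have h4 := rkN_insert_eq_card hG hd hk hB hnP hz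
  have h6 : (insert z B).card = 6 := by
    have h4' := card_sdiff_eq_four_of_not_bigP hG hd hk hB hnP
    have hd' : (gr M \ G).card ≤ 5 := by omega
    have hKB : coloops M G ⊆ B := coloops_subset_of_mem_thinMembers hG hd' hB
    have hzB : z ∉ B := fun h => (Finset.mem_sdiff.1 hz).2
      (subset_clF_of_subset_gr ((subset_G_of_mem_thinMembers hB).trans hGg) h)
    have h1' := Finset.card_sdiff_add_card_eq_card hKB
    rw [← kColoops_eq_card_coloops, hk, h4'] at h1'
    rw [Finset.card_insert_of_notMem hzB]
    omega
  omega

/-- **The dead points of three active faces lie on their basis line**: a point of `G` in the closures of the faces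
`Q.erase w`, `w ∈ A` (`A ⊆ Q`, e.g. the three active faces), lies in `cl (Q ∖ A)` — for `|A| = 3`, `A ⊆ Q ∖ K`, the closure
of `K` and two basis points. -/
theorem dead_mem_clF_of_three (hG : G ∈ flatsQ M (5 + 1)) (hd : (gr M \ G).card = 2) (hk : kColoops M G = 1)
    {B : Finset α} (hB : B ∈ thinMembers M 5 G) (hnP : ¬ bigP M G B) {z : α} (hz : z ∈ G \ clF M B)
    {A : Finset α} (hA : A ⊆ insert z B) {y : α} (hyG : y ∈ G)
    (hy : ∀ w ∈ A, y ∈ clF M ((insert z B).erase w)) : y ∈ clF M (insert z B \ A) :=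
  mem_clF_sdiff_of_forall_mem_clF_erase (indep_insert_of_basis_pair hG hd hk hB hnP hz)
    (mem_clF_insert_of_mem hG hd hk hB hnP hz hyG) A hA hy

end PercRepro.Shadow
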